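import Summits.KontsevichZagierPeriods.KontsevichZagierPeriods.Theorems.LinRedNormalFormHoffmanIndependenceSplit
import Summits.KontsevichZagierPeriods.KontsevichZagierPeriods.Theorems.LinRedNormalFormHoffmanIndependenceLevelOne
import Summits.KontsevichZagierPeriods.KontsevichZagierPeriods.Theorems.LinRedNormalFormHoffmanIndependenceTruncation

/-!
# Crux-strategist s1 — typed census for `HoffmanIndependence` (stmt-KontsevichZagierPeriods-15045)

Signatures referred to in `STRATEGY-CENSUS.md` (pass s1, 2026-08-17). Sorries, if any, are
deliberate census placeholders (statements examined, not claimed).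
-/

noncomputable section

set_option linter.dupNamespace false

namespace Summit.KontsevichZagierPeriods.KontsevichZagierPeriods.Cruxes.HoffmanIndependence.StrategistS1

open Literature.NumberTheory.Transcendental MZV
open Summit.KontsevichZagierPeriods.KontsevichZagierPeriods.Theses.LinRedNormalForm (HoffmanIndependence)
open Summit.KontsevichZagierPeriods.LinRedNormalForm.HoffmanIndependence

/-! ## Decomposition D1 — the children FILED by `route edit --split HoffmanIndependence` (verbatim) -/

/-- Child 1 (crux): weight grading of the Hoffman spans = Goncharov's Conj. 1.1 a) on `{2,3}^×`. -/
def HoffmanWeightGrading : Prop :=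
  iSupIndep Literature.NumberTheory.Transcendental.hoffmanSpan

/-- Child 2 (crux): in-weight independence = Zagier's dimension lower bound in Brown's basis. -/
def HoffmanInWeightIndependence : Prop :=
  ∀ n : ℕ, LinearIndependent ℚ (fun u : {u : List ℕ // Literature.NumberTheory.Transcendental.MZV.IsHoffman u ∧ Literature.NumberTheory.Transcendental.MZV.weight u = n} => Literature.NumberTheory.Transcendental.multipleZeta u.1)

/-- `--glue-by` check: the LANDED theorem (p137246) has exactly the type `Child₁ → Child₂ → Crux`. -/
theorem glue_by_check : HoffmanWeightGrading → HoffmanInWeightIndependence → HoffmanIndependence :=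
  HoffmanIndependence_of_subs

/-- Exactness of D1 (landed): neither child is the crux reworded, together they are the crux. -/
theorem split_exact : HoffmanIndependence ↔ HoffmanWeightGrading ∧ HoffmanInWeightIndependence :=
  hoffmanIndependence_iff_subs

/-- Child 2 is a THEOREM below weight 5 (landed `inWeight_of_le_four`). -/
theorem child2_le_four {n : ℕ} (hn : n ≤ 4) :
    LinearIndependent ℚ (fun u : {u : List ℕ // IsHoffman u ∧ weight u = n} => multipleZeta u.1) :=
  inWeight_of_le_four hn

/-! ## Decomposition D2 — the LEVEL split (Brown's own induction), typed; NOT filed -/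

/-- Hoffman values of level `≤ ℓ` (at most `ℓ` letters `3`) are `ℚ`-linearly independent. -/
def LevelLE (ℓ : ℕ) : Prop :=
  LinearIndependent ℚ (fun u : {u : List ℕ // IsHoffman u ∧ u.count 3 ≤ ℓ} => multipleZeta u.1)

/-- D2 piece 1: level `≤ 1` — by the landed `stub_levelOne_iff` (p140900) this is `ℚ`-linear
independence of `π^{2m}`, `π^{2m} ζ(2r+1)`; it CONTAINS both typed near-misses of Disproof §E
(`ζ(3) ∉ ℚ + ℚπ²` and `ζ(5) ∉ ℚ ζ(2)ζ(3)` are level-≤ 1 statements). -/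
def LevelOneIndependence : Prop := LevelLE 1

/-- D2 piece 2: the level step (motivically: injectivity of Brown's `∂_{N,ℓ}`; for real numbers its
only known mechanism is descent of the coaction to `ℝ` = the dead `coaction-descent` KerStable). -/
def LevelStep : Prop := ∀ ℓ : ℕ, 1 ≤ ℓ → LevelLE ℓ → LevelLE (ℓ + 1)

/-- the typing agrees with the landed level-one theorem -/
theorem levelOne_iff_classical :
    LevelOneIndependence ↔ LinearIndependent ℚ (fun p : ℕ × ℕ =>
        Real.pi ^ (2 * p.1) * (if p.2 = 0 then 1 else multipleZeta [2 * p.2 + 1])) :=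
  stub_levelOne_iff

/-- generic glue for filtration splits: a family covered by a monotone sequence of sub-families,
each linearly independent, is linearly independent. [folklore] -/
theorem linearIndependent_of_monotone_cover {ι R M : Type*} [Ring R] [AddCommGroup M] [Module R M]
    {v : ι → M} (P : ℕ → ι → Prop) (hmono : ∀ {m n : ℕ} {i : ι}, m ≤ n → P m i → P n i)
    (hcov : ∀ i, ∃ n, P n i) (h : ∀ n, LinearIndependent R (fun i : {i // P n i} => v i.1)) :
    LinearIndependent R v := by
  classical
  rw [linearIndependent_iff']
  intro s g hs i hi
  choose N hN using hcov
  have hP : ∀ j ∈ s, P (s.sup N) j := fun j hj => hmono (Finset.le_sup hj) (hN j)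
  have hL := h (s.sup N)
  rw [linearIndependent_iff'] at hL
  let emb : {j // j ∈ s} ↪ {i // P (s.sup N) i} :=
    ⟨fun j => ⟨j.1, hP j.1 j.2⟩, fun a b hab => by
      apply Subtype.ext
      have := congrArg Subtype.val hab
      simpa using this⟩
  have hsum : ∑ x ∈ s.attach.map emb, g x.1 • v x.1 = 0 := by
    rw [Finset.sum_map]
    have : ∑ x ∈ s.attach, g (emb x).1 • v (emb x).1 = ∑ x ∈ s.attach, g x.1 • v x.1 := rfl
    rw [this, Finset.sum_attach s (fun j => g j • v j)]
    exact hs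
  have key := hL (s.attach.map emb) (fun x => g x.1) hsum ⟨i, hP i hi⟩
    (Finset.mem_map.2 ⟨⟨i, hi⟩, Finset.mem_attach _ _, rfl⟩)
  exact key

/-- D2 glue (proved): level-one independence + the level step ⇒ the crux. -/
theorem hoffmanIndependence_of_levels (h1 : LevelOneIndependence) (hstep : LevelStep) :
    HoffmanIndependence := by
  have hall : ∀ ℓ, 1 ≤ ℓ → LevelLE ℓ := by
    intro ℓ hℓ
    induction ℓ, hℓ using Nat.le_induction with
    | base => exact h1
    | succ k hk ih => exact hstep k hk ih
  refine linearIndependent_of_monotone_cover (R := ℚ) (M := ℝ)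
    (v := fun u : {u : List ℕ // IsHoffman u} => multipleZeta u.1)
    (fun n (u : {u : List ℕ // IsHoffman u}) => u.1.count 3 ≤ n + 1)
    (fun hmn h => h.trans (Nat.succ_le_succ hmn)) (fun u => ⟨u.1.count 3, Nat.le_succ _⟩) ?_
  intro n
  -- transport `LevelLE (n+1)` along the obvious equivalence of index types
  have hL := hall (n + 1) (Nat.succ_pos n)
  let e : {i : {u : List ℕ // IsHoffman u} // i.1.count 3 ≤ n + 1} ≃
      {u : List ℕ // IsHoffman u ∧ u.count 3 ≤ n + 1} :=
    { toFun := fun i => ⟨i.1.1, i.1.2, i.2⟩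
      invFun := fun u => ⟨⟨u.1, u.2.1⟩, u.2.2⟩
      left_inv := fun i => rfl
      right_inv := fun u => rfl }
  exact (linearIndependent_equiv' e rfl).2 hL

/-! ## Strengthen S5 — deformation to `z = 1/q` (G-values near `0`), typed -/

/-- One-variable multiple polylogarithm `Li_s(x) = Σ_{n₁>…>n_k≥1} x^{n₁} / ∏ nᵢ^{sᵢ}` (junk `tsum`
conventions as for `multipleZeta`); `Li_s(1) = ζ(s)`. -/
def mplAt (s : List ℕ) (x : ℝ) : ℝ :=
  ∑' n : mzvIndexSet s.length, (if h : 0 < s.length then x ^ (n.1 ⟨0, h⟩) else 1) * mzvTerm s n.1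

theorem mplAt_one (s : List ℕ) : mplAt s 1 = multipleZeta s := by
  unfold mplAt multipleZeta
  congr 1
  ext n
  split <;> simp

/-- S5(N,q): the weight-`≤ N` Hoffman multiple-polylogarithm values at `1/q` are `ℚ`-linearly
independent. -/
def DeformedTruncation (N q : ℕ) : Prop :=
  LinearIndependent ℚ (fun u : {u : List ℕ // IsHoffman u ∧ weight u ≤ N} => mplAt u.1 (1 / (q : ℝ)))

/-- at `q = 1` the deformed statement is the weight-`≤ N` truncation of the crux (landed
`hoffmanIndependence_iff_forall_truncation`, p138708): the specialisation `q → 1` IS the crux. -/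
theorem deformedTruncation_one_iff (N : ℕ) :
    DeformedTruncation N 1 ↔
      LinearIndependent ℚ (fun u : {u : List ℕ // IsHoffman u ∧ weight u ≤ N} => multipleZeta u.1) := by
  unfold DeformedTruncation
  have : (fun u : {u : List ℕ // IsHoffman u ∧ weight u ≤ N} => mplAt u.1 (1 / ((1 : ℕ) : ℝ))) =
      fun u => multipleZeta u.1 := by
    funext u; simp [mplAt_one]
  rw [this]

theorem hoffmanIndependence_iff_forall_deformed_one :
    HoffmanIndependence ↔ ∀ N, DeformedTruncation N 1 := by
  rw [hoffmanIndependence_iff_forall_truncation]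
  exact forall_congr' fun N => (deformedTruncation_one_iff N).symm

/-! ## Strengthen S6 — the inductive truncation form -/

def TruncLE (N : ℕ) : Prop :=
  LinearIndependent ℚ (fun u : {u : List ℕ // IsHoffman u ∧ weight u ≤ N} => multipleZeta u.1)

/-- the inductive step; `TruncStep` at `N = 2` is rung 3 (`ζ(3) ∉ ℚ + ℚπ²`). -/
def TruncStep : Prop := ∀ N : ℕ, TruncLE N → TruncLE (N + 1)

theorem hoffmanIndependence_of_truncStep (h0 : TruncLE 0) (hstep : TruncStep) : HoffmanIndependence := by
  rw [hoffmanIndependence_iff_forall_truncation]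
  intro N
  induction N with
  | zero => exact h0
  | succ k ih => exact hstep k ih

end Summit.KontsevichZagierPeriods.KontsevichZagierPeriods.Cruxes.HoffmanIndependence.StrategistS1

end
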